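/-
Copyright: statement-level skeleton of a published paper (lit-balaban cell, Phase-2 proof seat p25, gen 21). No proof
claims beyond what the kernel checks below.
-/
import Literature.Probability.LatticeModels.PolymerGasGeometric
import Mathlib.Analysis.Complex.Exponential

/-!
# `BalabanImbrieJaffe1984to88.BIJ88WalkRegionWeightsSummable` — T. Bałaban, J. Imbrie, A. Jaffe, *Effective action and
cluster properties of the abelian Higgs model*, Commun. Math. Phys. **114** (1988) 257–315 [BalabanImbrieJaffe1988],
§5.14 p. 310 [PDF 54], verbatim: *"The others, localized in region X, have a factor of e^{−cr(e_k)|X|}. We also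
consider as remainders any terms whose order in λ and e is greater than n̄."* and (after the W₆′ estimate) *"(We allow
adjustments in β, α, β′, keeping them small.)"*, with Sect. 2 p. 264–265 [PDF 8–9]: *"The operator
C^{(k)}_{Λ,X}(u) depends only on u in X. It vanishes unless both arguments are in X, and is estimated as follows:
|C^{(k)}_{Λ,X}(u; x₁, x₂)| ≦ e^{−cr(e_k)|X|}. (2.46)"*, *"for any connected union of r(e_k) lattice cubes"* and *"|X|
refers to the number of r(e_k)-cubes in X"* — **THE WEIGHTS `λ^{|X|}` OF THE REGION PIECES ARE SUMMABLE THROUGH EVERY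
CUBE, PLAIN AND WITH THE MULTIPLICITY `|X|`** (p25 gen 21; file W4b, a MEMBER of row C2.Claim@312, owner r16, referee
ref-5; head of record `BIJ88WalkIneq312RemainderBdry.ineq312_remainder_bdry` UNCHANGED).

Gen 21's `BIJ88WalkWeightedLocalitySupports.weighted_locality_of_reach` reduces the weighted locality of the
interaction to two sums PER CUBE `k` over the pieces seeing `k`: `Σ ρ_p ≤ ρ₀` and `Σ ρ_p·|reach p k| ≤ ρ₁`.  For
print's region pieces `C_X` (`X` a connected union of cubes, seen only from inside `X`, reach `X`, weight
`ρ_X ≤ λ^{|X|}` with `λ = e^{−cr(e_k)}` or a root of it) both sums are lattice-animal sums through `k`: by the tree's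
animal bound `LatticeModels.sum_pow_card_le_of_connected` (`(Δ+1)²λ ≤ ½ ⇒ Σ_{Y ∋ k connected} λ^{|Y|} ≤ 2λ`),
`Σ_{X ∋ k} λ^{|X|} ≤ 2λ` and, since `|X| ≤ e^{|X|}`, `Σ_{X ∋ k} λ^{|X|}·|X| ≤ 2eλ` for `(Δ+1)²eλ ≤ ½`
(`region_weights_summable`) — volume-uniform constants for the region factors e^{−cr(e_k)|X|} of print p. 310 (our
reading of how such factors are summed; print itself only allows *"adjustments in β, α, β′, keeping them small"*).

statement-level skeleton of published theorems with citation tags; proofs where landed; nothing here is a claim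
about the Yang–Mills mass gap

PDF held: `paper:balaban1988-cmp114-bij-abelian-higgs-effective-action` (journal page = PDF page + 256); p. 310 = PDF
54, pp. 264–265 = PDF 8–9.

CITATION HEADER (lean-in-tree rule).  lit-balaban cell (HOME `run/shared/lean/pub/lit-balaban/`), Phase 2, seat p25
gen 21; row **C2.Claim@312** of `HOME/lit-balaban-r16/ROWS-C2-part2.md` (owner r16, referee ref-5; MEMBER).  USED BY
NAME, nothing restated: `Literature.Probability.LatticeModels.{IsRConnected, sum_pow_card_le_of_connected}` (the
lattice-animal bound); the consumer is `BIJ88WalkWeightedLocalitySupports.weighted_locality_of_reach` (p25 gen 21).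

## What is proved (0 `sorry`, standard axioms, no new `Prop` facts; theorems only, no definitions)

* **`region_weights_summable`**: for pieces `p` with INJECTIVELY attached connected regions `X p`, seen only from
  inside (`sees p k → k ∈ X p`), weights `ρ_p ≤ λ^{|X p|}`, `(Δ+1)²·eλ ≤ ½`: for every cube `k`,
  `Σ_{p : sees p k} ρ_p ≤ 2λ` and `Σ_{p : sees p k} ρ_p·|X p| ≤ 2eλ`.
HONEST SCOPE: (a) combinatorics of the weights only — no covariance, no walk expansion, no bound (2.46) is proved or
used here (they would supply `ρ_X ≤ λ^{|X|}`); (b) the local piece `C_loc` is not a region piece: it enters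
`weighted_locality_of_reach` separately with its bounded reach; (c) `λ` small in terms of the cube adjacency degree
`Δ`.  NOT summit progress; NOT continuum; NOT Clay.  Imports `LatticeModels.PolymerGasGeometric`,
`Mathlib.Analysis.Complex.Exponential`; modifies nothing.
-/

noncomputable section

namespace Literature.MathematicalPhysics.QuantumFieldTheory.BalabanImbrieJaffe1984to88.BIJ88WalkRegionWeightsSummable

open Classical Finset
open scoped BigOperators
open Literature.Probability.LatticeModels (IsRConnected sum_pow_card_le_of_connected)

variable {P : Type} [Fintype P] {K : Type} [DecidableEq K] {R : K → K → Prop} {nbr : K → Finset K} {Δ : ℕ}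

/-- `λ^n·n ≤ (eλ)^n` for `λ ≥ 0` (`n ≤ e^n`; bookkeeping). [folklore] -/
private theorem pow_mul_le_exp_pow {lam : ℝ} (hlam : 0 ≤ lam) (n : ℕ) :
    lam ^ n * (n : ℝ) ≤ (Real.exp 1 * lam) ^ n := by
  have hn : (n : ℝ) ≤ Real.exp 1 ^ n := by
    calc (n : ℝ) ≤ (n : ℝ) + 1 := by linarith
      _ ≤ Real.exp (n : ℝ) := Real.add_one_le_exp _
      _ = Real.exp 1 ^ n := (Real.exp_one_pow n).symm
  calc lam ^ n * (n : ℝ) ≤ lam ^ n * Real.exp 1 ^ n := mul_le_mul_of_nonneg_left hn (pow_nonneg hlam _)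
    _ = (Real.exp 1 * lam) ^ n := by rw [mul_pow, mul_comm]

/-- **THE WEIGHTS OF THE REGION PIECES ARE SUMMABLE THROUGH EVERY CUBE**: cubes `K` with a symmetric adjacency `R`
of degree `≤ Δ` (`nbr`); pieces `p` carrying injectively attached `R`-connected regions `X p`, seen from the cube `k`
only if `k ∈ X p`; weights `ρ_p ≤ λ^{|X p|}` with `λ ≥ 0`, `(Δ+1)²·eλ ≤ ½`.  Then for every cube `k`:
`Σ_{p : sees p k} ρ_p ≤ 2λ` and `Σ_{p : sees p k} ρ_p·|X p| ≤ 2eλ` — the inputs `hρ₀`, `hρ₁` of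
`BIJ88WalkWeightedLocalitySupports.weighted_locality_of_reach` for the region pieces, uniformly in the volume.
[cite: BalabanImbrieJaffe1988, §5.14 p.310, Sect. 2 (2.46) p.264–265] -/
theorem region_weights_summable [DecidableRel R] (hR : ∀ x y, R x y → R y x) (hΔ : ∀ x, (nbr x).card ≤ Δ)
    (hnbr : ∀ x y, R x y → y ∈ nbr x) {lam : ℝ} (hlam : 0 ≤ lam)
    (hsmall : ((Δ : ℝ) + 1) ^ 2 * (Real.exp 1 * lam) ≤ 1 / 2)
    {X : P → Finset K} (hX : Function.Injective X) (hconn : ∀ p, IsRConnected R (X p))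
    {sees : P → K → Prop} (hsees : ∀ p k, sees p k → k ∈ X p)
    {ρ : P → ℝ} (hρ : ∀ p, ρ p ≤ lam ^ (X p).card) (k : K) :
    (∑ p ∈ univ.filter (fun p => sees p k), ρ p) ≤ 2 * lam ∧
    (∑ p ∈ univ.filter (fun p => sees p k), ρ p * (X p).card) ≤ 2 * (Real.exp 1 * lam) := by
  have he1 : 1 ≤ Real.exp 1 := Real.one_le_exp zero_le_one
  have hlam' : 0 ≤ Real.exp 1 * lam := mul_nonneg (zero_le_one.trans he1) hlam
  have hsmall' : ((Δ : ℝ) + 1) ^ 2 * lam ≤ 1 / 2 :=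
    le_trans (mul_le_mul_of_nonneg_left (le_mul_of_one_le_left hlam he1) (by positivity)) hsmall
  -- the regions of the pieces seeing `k`: connected, through `k`, counted once each
  set F : Finset P := univ.filter fun p => sees p k with hF
  have himg : ∀ Y ∈ F.image X, k ∈ Y ∧ IsRConnected R Y := fun Y hY => by
    obtain ⟨p, hp, rfl⟩ := Finset.mem_image.1 hY
    exact ⟨hsees p k (Finset.mem_filter.1 hp).2, hconn p⟩
  have hsum : ∀ μ : ℝ, ∑ p ∈ F, μ ^ (X p).card = ∑ Y ∈ F.image X, μ ^ Y.card := fun μ => by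
    rw [Finset.sum_image fun p _ q _ h => hX h]
  constructor
  · calc ∑ p ∈ F, ρ p ≤ ∑ p ∈ F, lam ^ (X p).card := Finset.sum_le_sum fun p _ => hρ p
      _ = ∑ Y ∈ F.image X, lam ^ Y.card := hsum lam
      _ ≤ 2 * lam := sum_pow_card_le_of_connected hR hΔ hnbr hlam hsmall' k _ himg
  · calc ∑ p ∈ F, ρ p * (X p).card ≤ ∑ p ∈ F, lam ^ (X p).card * (X p).card :=
          Finset.sum_le_sum fun p _ => mul_le_mul_of_nonneg_right (hρ p) (Nat.cast_nonneg _)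
      _ ≤ ∑ p ∈ F, (Real.exp 1 * lam) ^ (X p).card := Finset.sum_le_sum fun p _ => pow_mul_le_exp_pow hlam _
      _ = ∑ Y ∈ F.image X, (Real.exp 1 * lam) ^ Y.card := hsum _
      _ ≤ 2 * (Real.exp 1 * lam) := sum_pow_card_le_of_connected hR hΔ hnbr hlam' hsmall k _ himg

end Literature.MathematicalPhysics.QuantumFieldTheory.BalabanImbrieJaffe1984to88.BIJ88WalkRegionWeightsSummable

end
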